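import Mathlib
import Summits.Ventures.PercRepro2.HallReading

/-! # Up-set domination is EQUIVALENT to the private assignment
(seat mine-b, cell pub-perc-repro2; MINE-B.md §19.2)

`HallReading.lean` derives the private assignment from `UpDom`; here the converse: an injective
assignment of the slots `(x ∈ A, i < r x)` to configurations above `x` in `B = {r = 1, b ≥ 1}`
forces every upper set `W` to contain at least `Σ_{W ∩ A} r` elements of `B` (the targets of the
slots of `W ∩ A` lie in `W` and are distinct), i.e. `UpDom`.  So **(V2) ⟺ private targets**
(`upDom_iff_exists_private_targets`). -/

namespace Summit.Ventures.PercRepro2.V2Closure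

open Finset

variable {X : Type*} [Preorder X] [Fintype X] [DecidableEq X] [DecidableRel (α := X) (· ≤ ·)]

/-- the slots whose source lies in `W` -/
def slotsIn (r b : X → ℕ) (W : Finset X) : Finset (Slot r b) :=
  univ.filter (fun p => p.1.1.1 ∈ W)

omit [Preorder X] [DecidableRel (α := X) (· ≤ ·)] in
/-- the number of slots over `W` is the `r`-weighted count of `W ∩ A` -/
lemma card_slotsIn (r b : X → ℕ) (W : Finset X) :
    ((slotsIn r b W).card : ℤ) = ∑ x ∈ W, wA r b x := by
  -- count fibrewise over the sources
  have h : ((slotsIn r b W).card : ℤ)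
      = ∑ x : Src r b, (((slotsIn r b W).filter (fun p => p.1.1 = x)).card : ℤ) := by
    rw [Finset.card_eq_sum_card_fiberwise (f := fun p : Slot r b => p.1.1) (t := univ)
      (fun _ _ => mem_univ _)]
    push_cast; rfl
  rw [h]
  -- each source in `W` carries exactly `r x` slots, each source outside `W` none
  have hfib : ∀ x : Src r b, (((slotsIn r b W).filter (fun p => p.1.1 = x)).card : ℤ)
      = if x.1 ∈ W then (r x.1 : ℤ) else 0 := by
    intro x
    split_ifs with hx
    · -- bijection with `Finset.range (r x.1)` via the replica index
      have : ((slotsIn r b W).filter (fun p => p.1.1 = x)).card = (Finset.range (r x.1)).card := by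
        apply Finset.card_bij (fun p _ => p.1.2.val)
        · intro p hp
          simp only [mem_filter] at hp
          simp only [Finset.mem_range]
          rw [← hp.2]; exact p.2
        · intro p hp q hq hpq
          simp only [mem_filter] at hp hq
          apply Subtype.ext; apply Prod.ext
          · rw [hp.2, hq.2]
          · exact Fin.ext hpq
        · intro i hi
          simp only [Finset.mem_range] at hi
          refine ⟨⟨(x, ⟨i, lt_trans hi (lt_bound r x.1)⟩), hi⟩, ?_, rfl⟩
          simp [slotsIn, hx]
      simpa using this
    · have : (slotsIn r b W).filter (fun p => p.1.1 = x) = ∅ := by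
        apply Finset.filter_eq_empty_iff.2
        intro p hp hpx
        simp only [slotsIn, mem_filter, mem_univ, true_and] at hp
        rw [hpx] at hp; exact hx hp
      rw [this]; simp
  simp only [hfib]
  -- regroup: the sum over `Src` of `[x ∈ W] r x` is the `A`-weighted sum over `W`
  rw [← Finset.sum_filter]
  have e : ∑ x ∈ W, wA r b x = ∑ x ∈ W.filter (fun x => b x = 0 ∧ 2 ≤ r x), (r x : ℤ) := by
    rw [Finset.sum_filter]; apply Finset.sum_congr rfl; intro x _; simp only [wA]
  rw [e]
  symm
  apply Finset.sum_bij (fun x hx => (⟨x, (Finset.mem_filter.1 hx).2⟩ : Src r b))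
  · intro x hx; simp only [mem_filter, mem_univ, true_and]; exact (Finset.mem_filter.1 hx).1
  · intro x _ y _ h; exact Subtype.mk.inj h
  · intro y hy
    simp only [mem_filter, mem_univ, true_and] at hy
    exact ⟨y.1, Finset.mem_filter.2 ⟨hy, y.2⟩, rfl⟩
  · intro x _; rfl

omit [DecidableRel (α := X) (· ≤ ·)] in
/-- **the converse**: a private assignment forces up-set domination -/
theorem upDom_of_private_targets (r b : X → ℕ)
    (h : ∃ f : Slot r b → X, Function.Injective f ∧
      ∀ p : Slot r b, p.1.1.1 ≤ f p ∧ r (f p) = 1 ∧ 1 ≤ b (f p)) : UpDom r b := by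
  obtain ⟨f, hf, hspec⟩ := h
  intro W hW
  -- the targets of the slots over `W` are distinct elements of `W ∩ B`
  have himg : (slotsIn r b W).image f ⊆ W.filter (fun y => r y = 1 ∧ 1 ≤ b y) := by
    intro y hy
    obtain ⟨p, hp, rfl⟩ := Finset.mem_image.1 hy
    simp only [slotsIn, mem_filter, mem_univ, true_and] at hp
    obtain ⟨hle, h1, h2⟩ := hspec p
    exact Finset.mem_filter.2 ⟨hW hle hp, h1, h2⟩
  have hcard : (slotsIn r b W).card ≤ (W.filter (fun y => r y = 1 ∧ 1 ≤ b y)).card := by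
    rw [← Finset.card_image_of_injective _ hf]
    exact Finset.card_le_card himg
  have hB : ((W.filter (fun y => r y = 1 ∧ 1 ≤ b y)).card : ℤ) = ∑ y ∈ W, indB r b y := by
    rw [Finset.card_filter]; push_cast; rfl
  have hsplit : ∑ y ∈ W, nu' r b y = ∑ y ∈ W, indB r b y - ∑ y ∈ W, wA r b y := by
    rw [← Finset.sum_sub_distrib]
    exact Finset.sum_congr rfl (fun y _ => nu'_eq r b y)
  have h1 := card_slotsIn r b W
  have h2 : ((slotsIn r b W).card : ℤ) ≤ ((W.filter (fun y => r y = 1 ∧ 1 ≤ b y)).card : ℤ) := by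
    exact_mod_cast hcard
  linarith

/-- **(V2) ⟺ the private assignment.** -/
theorem upDom_iff_exists_private_targets (r b : X → ℕ) :
    UpDom r b ↔ ∃ f : Slot r b → X, Function.Injective f ∧
      ∀ p : Slot r b, p.1.1.1 ≤ f p ∧ r (f p) = 1 ∧ 1 ≤ b (f p) :=
  ⟨exists_private_targets_of_upDom r b, upDom_of_private_targets r b⟩

end Summit.Ventures.PercRepro2.V2Closure
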